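import Mathlib
import HarnessLib
import HarnessLib.Audit
import Summits.AtomisticToContinuum.Statement
import Literature.Geometry.DiscreteGeometry.KissingPatterns
import Literature.Geometry.DiscreteGeometry.FejesTothKissingTwelve
import Literature.MathematicalPhysics.StatisticalMechanics.HaggStacking
import Literature.MathematicalPhysics.StatisticalMechanics.BarlowStacking
import Literature.MathematicalPhysics.StatisticalMechanics.LennardJonesClusters
import Literature.MathematicalPhysics.StatisticalMechanics.Crystallization

/-!
Route: OctetTrussRigidity

CLOSED (retired) 2026-08-15T13:55:55Z by operator:999:2305528 — reason: not-a-thesis: assembly does not conclude the sub-problem Statement — note: D-0027 §2.1 audit (human 2026-08-15: routes that do not decide the summit are removed): the assembly concludes `Literature.MathematicalPhysics.StatisticalMechanics.Crystallization`, not the sub-problem statement; a NEW conforming route may be opened from the same idea (generated `closes : … → _root_. The file is kept as the record of this route; refuted decls are indexed as negative knowledge (`ledger negatives`).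

OctetTrussRigidity (card octet-truss-korn-jitterbug). It suffices to show X := SoftDoubleShell ∧
DoubleStarRigidity ∧ SoftBallBarlow, the three-piece anatomy of the K-line's rank-2 crux 0758
(RobustFejesTothHales), together with the shared K-line tail (BulkDefectVanish 0751, periodic
minimum 0627, energy limit 0626).
(A) SoftDoubleShell [compactness, rate-free, Hales's facts flyspeck_L12 and
Hales2012_kissingConfigCongruent as antecedents]: for every eps there is eta0 such that if every
point of S within distance 4 of x is softly twelve-coordinated with slack eta < eta0
((1-eta)-separated, exactly 12 within 1+eta, none in (1+eta,5/4)), then the 12-shell AND the 6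
second-shell points of x at distance in [5/4,3/2] are eps-matched, after one linear isometry, to the
fcc double shell (cuboctahedron + 6 octahedral caps at sqrt2) or the hcp double shell
(anticuboctahedron + its 6 caps).
(B) DoubleStarRigidity [linear algebra]: both 19-point double stars (centre + 12 + 6; 60 unit bars)
are first-order rigid (own exact rank computation: 51 = 3*19-6, whereas the 13-point shell
frameworks have rank 32 < 33: one jitterbug flex), hence Lipschitz-stable: eps1-close with all bars
in [1-eta,1+eta] implies C*eta-close.
(C) SoftBallBarlow [local-to-global on balls]: if every point of S in B_R(p) has a delta-close
double shell (delta <= delta0 absolute), then S ∩ B_{R-2}(p) lies within K(R)*delta of a rigid image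
of a Barlow stacking barlowStacking 1 sqrt(2/3) s, IsHaggSeq s.
Glue (support RobustFromParts): (A) → (B) → (C) → flyspeck_L12 → Hales2012_kissingConfigCongruent →
RobustFejesTothHales with eta0 = min(eta_A(eps1), eps1, delta0/max(1,C_B)), C = C_B, R0 = 12, C'(R)
= K(R-4)*max(1,C_B).
Lean: Assembly := SoftDoubleShell → DoubleStarRigidity → SoftBallBarlow → RobustFromParts →
DefectVanishCrystallizes → BulkDefectVanish →
Literature.MathematicalPhysics.StatisticalMechanics.LennardJonesMinimalDistance → (∃ P, IsLeast
(range energyPerParticle lennardJones) (P.energyPerParticle lennardJones)) → Tendsto (E(N)/N) atTop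
(nhds ⨅ periodic) → Literature.MathematicalPhysics.StatisticalMechanics.Crystallization; all
constants exist (lean check rc 0): Literature.Geometry.DiscreteGeometry.{EtaMatched, ShellCloseTo,
fccKissingPattern, hcpKissingPattern, scaledPattern, flyspeck_L12,
Hales2012_kissingConfigCongruent}, Literature.MathematicalPhysics.StatisticalMechanics.{IsHaggSeq,
barlowStacking, PeriodicConfiguration, IsGroundState, lennardJones, IsCrystallizing,
groundStateEnergy, LennardJonesMinimalDistance, Crystallization}.

Rationale: WHY THIS LINE. 0758 (robust Fejes Toth-Hales with LINEAR rate C*eta) is the K-line's rank-2 crux and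
has no line of attack in print (no eta>0 version; BoroczkySzabo2016 unread, acq-00697). The card's
rigidity audit locates where linearity can and cannot come from: the centred fcc/hcp 12-shell bar
frameworks (12 spokes + 24 contacts) have exactly ONE non-trivial first-order flex (the linearised
jitterbug; own exact rank computation 32 of 33, both patterns), so any single-shell argument yields
at best sqrt(eta) (support ShellSqrtFlex records the witness), while the 19-point DOUBLE STAR (8
tetrahedra + 6 octahedra around a vertex = shell + 6 octahedral caps at sqrt2, 60 bars) is
first-order rigid (rank 51 of 51, both patterns; the centre-free 18-point double shell is even
isostatic 48/48) because adjacent cells share triangular faces. Hence 0758 = (A) a rate-free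
compactness step resting on facts IN THE TREE (flyspeck_L12, Hales2012_kissingConfigCongruent; Thm 1
is local at radius 2 since shell(x) in class V needs L12 only at the twelve neighbours; caps exist
by the square-diagonal lemma; no extra 1-separated point fits at distance [5/4,3/2]: own clearance
bound 0.904 fcc / 0.895 hcp < 1) + (B) finite-dimensional Lipschitz stability from infinitesimal
rigidity (AsimowRoth1978-type) + (C) a developing-map / star-chaining step on the ball (rotation
drift <= C*delta per contact step, K(R) ~ R^2). Imported areas: bar-framework rigidity (Cauchy-Dehn,
AsimowRoth1978, ConnellyWhiteley1996 for the negative side), geometric rigidity / discrete Korn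
(FrieseckeJamesMuller2002, Schmidt2009, LazzaroniPalombaroSchlomerkemper2017 - sharpens K(R) only,
filed as support TrussKorn for energy consumers), Hales2012 arXiv:1209.6043 + HalesDSP2012 Sec. 1.3
layer propagation (tree: LayerStackings, infinite packings only).
RANKED CRUXES. #2 SoftBallBarlow (C) - finite-ball local-to-global with free boundary, linear in the
per-star error, uniform delta0 (why it might fail: holonomy of the layer-normal field, bent
fully-coordinated textures since L^infty-Korn fails, fcc regions with ambiguous layer normal beside
hcp-type vertices; unproved even at eta = 0 on balls - tree has only HalesDSP_layerPackings_holds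
for infinite packings; sources HalesDSP2012, FrieseckeJamesMuller2002). #3 SoftDoubleShell (A) -
compactness + local Hales + caps + hole exclusion with the two computer-assisted facts as
antecedents (why it might fail: only if Thm 1 were not local at radius <= 4 or a 13th contact / 7th
cap survived the limit - excluded by the 5/4 gap and the clearance bound; sources Hales2012,
KusnerKusnerLagariasShlosman2018). #4 DoubleStarRigidity (B) - Lipschitz stability of both double
stars (why it might fail: rank 51/51 certified here in exact arithmetic but to be re-certified in
Lean/kit; quantitative inverse-function bookkeeping modulo O(3), size of C; sources AsimowRoth1978,
ConnellyWhiteley1996). #5 BulkDefectVanish (= 0751, shared K-line hinge) and #6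
CrysPeriodicMinAttained (= 0627, shared): the LJ-specific tail, unchanged, with their recorded risks
(vertex-transitivity / single P; Hagg domination 1e-4 margin).
KILL CRITERIA. (C) refuted - a fully coordinated, locally-Barlow finite configuration on a ball not
within K*delta of any Barlow fragment for small delta - closes this route and falsifies 0758(2)
itself; (A) refuted would mean Hales's theorem is not local, contradicting the tree's architecture
(isKissingConfig_kissingShell, hales2012_kissingTwelve_of_L12); (B) cannot die as a rank statement
(51/51 exact), only its constants matter. Refutation of 0751 or 0627 kills the K-line tail, not the
anatomy (A)-(C), which then serves brittle-rung-mie-descent (B4) and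
energy-derivative-positional-order (step 5).
NOT DECOMPOSED YET. (i) the eta = 0 finite-ball layer theorem under (C) (provers attach it with
--supports SoftBallBarlow); (ii) effective eta0; (iii) TrussKorn's nonlinear FJM form; (iv) the
K-line hinge, which this audit shows is NOT 0758+0750+0759 => 0751 as typed: 0758 lives at absolute
scale 1 with separation 1-eta while LJ has a* ~ 0.971 and the hcp optimum has two bond lengths (c/a
non-ideal, spread ~1e-4), so a non-effective eta0 cannot be certified >= eta_LJ and ideal-Barlow
closeness C'(R)*eta cannot feed eps -> 0 windows; the honest hinge needs (a,h)-free targets + metric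
exactness of near-truss ground states (cards excess-decay-epsilon-regularity / one-grain-sbv-window)
or an effective eta0 (card robust-fejes-toth-by-certificate-slack (2)). No glue toward 0751 is typed
here; the assembly takes 0751 as hypothesis exactly like CrystalKissingRigidity's 0753.
CHEAPEST FALSIFIER. For (B)/(A): re-run the two exact rank computations (13-point shell: expect 32;
19-point double star: expect 51) and the clearance maximisation on [5/4,3/2] (expect < 1) - minutes
in exact/float arithmetic (folder calc/rank.py, calc/holes.py). For (C): penalty-minimisation search
for 60-200-point configurations in a ball with every interior double star within delta = 0.02 of a
pattern but total misfit to every Barlow fragment >= 0.3 (a bent or twisted grain); one hit with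
delta -> 0 scaling kills (C).
NUMBERS. rank(13-pt shell) = 32/33 (fcc, hcp); rank(19-pt double star) = 51/51; rank(18-pt
centre-free) = 48/48; clearance for a 20th point at radius [1.25,1.5]: 0.904 (fcc), 0.895 (hcp);
pattern distances: 1, sqrt2, sqrt(8/3)=1.633 (hcp), sqrt3; R0 = 12, hypothesis radius 4, cap window
[5/4,3/2].
SOURCES. Hales2012 (arXiv:1209.6043) Thm 1, Lemma 2, Lemma 10; HalesDSP2012 Sec. 1.3;
KusnerKusnerLagariasShlosman2018 (arXiv:1611.10297); ConnellyWhiteley1996; AsimowRoth1978;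
FrieseckeJamesMuller2002; Schmidt2009; LazzaroniPalombaroSchlomerkemper2017; FlatleyTheil2015
(arXiv:1407.0692); BoroczkySzabo2016; ConwaySloane1999 Ch. 1.

Novelty: Grade claimed: new-combination (card graded new-combination by refuter-novelty-audit-4, 2026-08-15).
Nearest prior art actually found: (1) single-shell flexibility: KusnerKusnerLagariasShlosman2018
arXiv:1611.10297 (configuration space of twelve spheres; fcc/hcp arrangements deform as packings),
ConwaySloane1999 Ch.1 Sec.2.1 ('rolling'), tree barrier
Literature.Barriers.AtomisticToContinuum.FlexibleKissingArrangements (icosahedral witness); Fuller's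
jitterbug; ConnellyWhiteley1996 doi:10.1137/S0895480192229236 (second-order rigidity) - none states
the centred 13-point framework's corank (computed here exactly: rank 32 of 33 for both patterns).
(2) exact classification: Hales2012 arXiv:1209.6043 Thm 1 / Lemma 2 / Lemma 10 (tree:
FejesTothKissingTwelve, KissingRigidity), BoroczkySzabo2015/2016 (doi:10.1007/s10474-015-0527-4,
doi:10.1007/s10474-016-0583-4; 2016 = epsilon-quasi-twelve-neighbour constructions, paywalled
acq-00697) - no eta>0 stability theorem in print (crossref 'Fejes Toth twelve neighbour packing
stability' this session: only the 1981/1973 Fejes Toth neighbour papers). (3) cell rigidity +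
discrete Korn for 3-D lattices: Schmidt2009 doi:10.3934/nhm.2009.4.789,
LazzaroniPalombaroSchlomerkemper2017 doi:10.3934/dcdss.2017007, inside a crystallization proof
FlatleyTheil2015 arXiv:1407.0692; FrieseckeJamesMuller2002. (4) in-pool:
robust-fejes-toth-by-certificate-slack (compactness part (1) = my (A) without the second shell;
certificate mining), two-shell-rigidity-certi  [refs: 10.1137/S0895480192229236, 10.1007/s10474-015-0527-4, 10.1007/s10474-016-0583-4, 10.3934/nhm.2009.4.789, 10.3934/dcdss.2017007, 1611.10297, 1209.6043, 1407.0692, 2604.19239, doi:10.1137/S0895480192229236, doi:10.1007/s10474-015-0527-4, doi:10.1007/s10474-016-0583-4, doi:10.3934/nhm.2009.4.789, doi:10.3934/dcdss.2017007, KusnerKusnerLagariasShlosman2018, ConwaySloane1999, ConnellyWhiteley1996, Hale]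

Barriers (technique_class: bar-framework-rigidity discrete-Korn kissing-twelve): - technique_class: bar-framework-rigidity discrete-Korn kissing-twelve compactness
- Literature.Barriers.AtomisticToContinuum.FlexibleKissingArrangements: APPLIES to every
single-shell statement and is SHARPENED here (support ShellSqrtFlex: even the maximal-contact fcc
shell moves ~sqrt(eta) at contact slack eta via the jitterbug flex; rank 32/33). Evaded exactly as
Hales evades it and one step further: hypotheses at ALL points within distance 4 (crux
SoftDoubleShell) put every limit shell in class V, and the SECOND shell (6 octahedral caps) makes
the 19-point double star first-order rigid (rank 51/51), which is where the linear rate lives (crux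
DoubleStarRigidity).
- Literature.Barriers.AtomisticToContinuum.KissingTwelveDegeneracy: RESPECTED - the output of
(A)-(C) and of 0758 is 'some Hagg sequence s'; no stacking is selected below sqrt(8/3); selection
stays with the shared tail (0751 via 0759/0737, certified J_k 0670).
- Literature.Barriers.AtomisticToContinuum.ShortRangeStackingBlindness: same remark; TrussKorn's
constant is uniform in s precisely because contacts never see the stacking.
- Literature.Barriers.AtomisticToContinuum.TetrahedralFrustration / IcosahedralClusters: NOT MET -
the line starts after soft twelve-coordination with the 5/4 gap (icosahedral shells violate the
all-points hypothesis; multiply-twinned textures carry a fixed strain ~1.5% and are excluded once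
delta0 is below it); it does not claim 0750.
- Literature.Barriers.AtomisticToContinuum.StickySphe

History (route lifecycle, newest last):
- 2026-08-15T13:55:55Z · CLOSED retired — not-a-thesis: assembly does not conclude the sub-problem Statement (operator:999:2305528)

sub-problem: Crystallization · status: closed(retired) · opened planner-plancard-AtomisticToContinuum-Crystal-578c4749-0 2026-08-15T11:27:42Z · rev 0 · ledger route-AtomisticToContinuum-OctetTrussRigidity
GENERATED by the gate from the ledger (D-0016/17). Provers cite these decls: `theorem foo : Summit.AtomisticToContinuum.Crystallization.Theses.OctetTrussRigidity.<Decl> := …` in Summits/AtomisticToContinuum/Crystallization/Theorems/<Name>.lean.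
-/

namespace Summit.AtomisticToContinuum.Crystallization.Theses.OctetTrussRigidity

open scoped BigOperators Topology Manifold Classical MeasureTheory ProbabilityTheory Matrix InnerProductSpace ComplexConjugate ContinuousMap
open Filter Set Function TopologicalSpace MeasureTheory

attribute [summit_statement] _root_.Crystallization

/-- item stmt-AtomisticToContinuum-4103 · crux · rank 2 · closed · moot by None · by planner
why it might fail: Finite-ball local-to-global with free boundary is unproved even at eta=0 (tree: infinite packings only); holonomy of the layer-normal field / bent fully-coordinated textures (L^inf-Korn fails); fcc regions with 4 candidate layer normals beside hcp-type vertices.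
sources: HalesDSP2012 Sec. 1.3 (tree LayerStackings.lean: HalesDSP_layerPackings_holds, infinite form only), FrieseckeJamesMuller2002 (geometric rigidity; L2 not Linfty), Hales2012 arXiv:1209.6043 Sec. 1, Theil2006 (2-D local-to-global with defects as template)
[crux] (C) LOCAL-TO-GLOBAL ON BALLS, linear in the per-star error, uniform threshold: there are
delta0 > 0 and K : R -> R such that for 0 <= eta <= delta <= delta0, every (1-eta)-separated S and
every ball B_R(p) in which every point of S has the 5/4-gap and an 18-point double shell (12 within
1+eta, 6 at distance in [5/4,3/2]) delta-matched after one linear isometry to the fcc double shell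
(cuboctahedron + caps scaledPattern{(+-2,0,0),...} 2) or the hcp double shell (anticuboctahedron +
caps scaledPattern{(6,0,0),(0,6,0),(0,0,6),(2,-4,-4),(-4,2,-4),(-4,-4,2)} 18): S cap B_{R-2}(p) lies
pointwise within K(R)*delta of g(barlowStacking 1 sqrt(2/3) s), IsHaggSeq s, g an affine isometry.
delta = 0 is the finite-ball form of HalesDSP Sec. 1.3 (tree: LayerPropagation/LayerStackings prove
the INFINITE-packing form HalesDSP_layerPackings_holds). Intended proof: combinatorics is local
(delta0-close double stars => the soft contact graph is locally the octet-truss graph with >= 4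
non-coplanar common points between adjacent stars), developing map on the simply connected clique
2-complex of the truss graph in the ball, metric chaining with rotation drift <= C*delta per step
(K(R) ~ R^2; L^inft -/
@[route_item "route-AtomisticToContinuum-OctetTrussRigidity"]
def SoftBallBarlow : Prop :=
  ∃ δ₀ : ℝ, 0 < δ₀ ∧ ∃ K : ℝ → ℝ, ∀ η δ : ℝ, 0 ≤ η → η ≤ δ → δ ≤ δ₀ → ∀ (R : ℝ) (p : EuclideanSpace ℝ (Fin 3)) (S : Set (EuclideanSpace ℝ (Fin 3))), (∀ y ∈ S, ∀ z ∈ S, y ≠ z → 1 - η ≤ dist y z) → (∀ x ∈ S, dist x p ≤ R → (∀ z ∈ S, ¬ (1 + η < dist x z ∧ dist x z < 5 / 4)) ∧ ∃ T U : Finset (EuclideanSpace ℝ (Fin 3)), (↑T : Set (EuclideanSpace ℝ (Fin 3))) = (fun z => z - x) '' {z ∈ S | z ≠ x ∧ dist x z ≤ 1 + η} ∧ (↑U : Set (EuclideanSpace ℝ (Fin 3))) = (fun z => z - x) '' {z ∈ S | 5 / 4 ≤ dist x z ∧ dist x z ≤ 3 / 2} ∧ ∃ A : EuclideanSpace ℝ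 (Fin 3) →ₗᵢ[ℝ] EuclideanSpace ℝ (Fin 3), ((Literature.Geometry.DiscreteGeometry.EtaMatched (δ) T ((Literature.Geometry.DiscreteGeometry.fccKissingPattern).image A) ∧ Literature.Geometry.DiscreteGeometry.EtaMatched (δ) U ((Literature.Geometry.DiscreteGeometry.scaledPattern {![2, 0, 0], ![-2, 0, 0], ![0, 2, 0], ![0, -2, 0], ![0, 0, 2], ![0, 0, -2]} 2).image A)) ∨ (Literature.Geometry.DiscreteGeometry.EtaMatched (δ) T ((Literature.Geometry.DiscreteGeometry.hcpKissingPattern).image A) ∧ Literature.Geometry.DiscreteGeometry.EtaMatched (δ) U ((Literature.Geometry.DiscreteGeometry.scaledPattern {![6, 0, 0], ![0, 6, 0], ![0, 0, 6], ![2, -4, -4], ![-4, 2, -4], ![-4, -4, 2]} 18).image A)))) → ∃ (s : ℤ → ℤ) (g : EuclideanSpace ℝ (Fin 3) ≃ᵃⁱ[ℝ] EuclideanSpace ℝ (Fin 3)), Literature.MathematicalPhysics.StatisticalMechanics.IsHaggSeq s ∧ ∀ x ∈ S, dist x p ≤ R - 2 → ∃ z ∈ Literature.MathematicalPhysics.StatisticalMechanics.barlowStacking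 1 (Real.sqrt (2 / 3)) s, dist x (g z) ≤ K R * δ

/-- item stmt-AtomisticToContinuum-4104 · crux · rank 3 · closed · moot by None · by planner
why it might fail: Only if Hales Thm 1 were not local at radius <=4 (it is: shell in class V needs L12 at the 12 neighbours only) or a 13th contact / 7th point in [5/4,3/2] survived the limit - excluded by the 5/4 gap and clearance 0.904<1; risk = size (L).
sources: Hales2012 arXiv:1209.6043 Thm 1, Lemma 2, Lemma 10 (tree: Hales2012_kissingConfigCongruent, isKissingConfig_kissingShell, hales2012_separation_of_L12), KusnerKusnerLagariasShlosman2018 arXiv:1611.10297 (why one shell is not enough), BoroczkySzabo2016 doi:10.1007/s10474-016-0583-4 (eps-quasi-12-neighbour constructions; standing threat, acq-00697), folder calc/holes.py (clearance 0.904 fcc / 0.895 hcp)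
[crux] (A) RATE-FREE ROBUST FEJES TOTH WITH SECOND SHELL (compactness; the two computer-assisted
tree facts flyspeck_L12 and Hales2012_kissingConfigCongruent as antecedents): for every eps > 0
there is eta0 > 0 such that for 0 < eta < eta0, if S is (1-eta)-separated and every point of S
within distance 4 of x in S is softly twelve-coordinated (exactly 12 points of S within 1+eta, none
at distance in (1+eta,5/4)), then the recentred 12-shell T and the recentred set U of points at
distance in [5/4,3/2] from x are eps-matched (EtaMatched, one common linear isometry A) to
(fccKissingPattern, 6 fcc caps at sqrt2) or to (hcpKissingPattern, 6 hcp caps). Proof plan: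
contradiction + Hausdorff compactness of S_k cap B_6(x_k) (bounded cardinality by separation); the
limit is exactly kissing-12 with the 5/4 gap near 0; local Lemma 2 (L12 at the twelve neighbours)
puts shell(0) in Hales's class V; Hales2012_kissingConfigCongruent gives the pattern; pattern shells
at the 12 neighbours force the 6 octahedral caps (unique antipode on the circle about a square
diagonal); no further 1-separated point fits at radius [5/4,3/2] (own clearance bound 0.904/0.895 <
1); closeness passes back to S_k. [deps: -/
@[route_item "route-AtomisticToContinuum-OctetTrussRigidity"]
def SoftDoubleShell : Prop :=
  Literature.Geometry.DiscreteGeometry.flyspeck_L12 → Literature.Geometry.DiscreteGeometry.Hales2012_kissingConfigCongruent → ∀ ε : ℝ, 0 < ε → ∃ η₀ : ℝ, 0 < η₀ ∧ ∀ η : ℝ, 0 < η → η < η₀ → ∀ (S : Set (EuclideanSpace ℝ (Fin 3))) (x : EuclideanSpace ℝ (Fin 3)), x ∈ S → (∀ y ∈ S, ∀ z ∈ S, y ≠ z → 1 - η ≤ dist y z) → (∀ y ∈ S, dist y x ≤ 4 → ({z ∈ S | z ≠ y ∧ dist y z ≤ 1 + η}.ncard = 12 ∧ ∀ z ∈ S,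 ¬ (1 + η < dist y z ∧ dist y z < 5 / 4))) → ∃ T U : Finset (EuclideanSpace ℝ (Fin 3)), (↑T : Set (EuclideanSpace ℝ (Fin 3))) = (fun z => z - x) '' {z ∈ S | z ≠ x ∧ dist x z ≤ 1 + η} ∧ (↑U : Set (EuclideanSpace ℝ (Fin 3))) = (fun z => z - x) '' {z ∈ S | 5 / 4 ≤ dist x z ∧ dist x z ≤ 3 / 2} ∧ ∃ A : EuclideanSpace ℝ (Fin 3) →ₗᵢ[ℝ] EuclideanSpace ℝ (Fin 3), ((Literature.Geometry.DiscreteGeometry.EtaMatched (ε) T ((Literature.Geometry.DiscreteGeometry.fccKissingPattern).image A) ∧ Literature.Geometry.DiscreteGeometry.EtaMatched (ε) U ((Literature.Geometry.DiscreteGeometry.scaledPattern {![2, 0, 0], ![-2, 0, 0], ![0, 2, 0], ![0, -2, 0], ![0, 0, 2], ![0, 0, -2]} 2).image A)) ∨ (Literature.Geometry.DiscreteGeometry.EtaMatched (ε) T ((Literature.Geometry.DiscreteGeometry.hcpKissingPattern).image A) ∧ Literature.Geometry.DiscreteGeometry.EtaMatched (ε) U ((Literature.Geometry.DiscreteGeometry.scaledPattern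 {![6, 0, 0], ![0, 6, 0], ![0, 0, 6], ![2, -4, -4], ![-4, 2, -4], ![-4, -4, 2]} 18).image A)))

/-- item stmt-AtomisticToContinuum-4105 · crux · rank 4 · closed · moot by None · by planner
why it might fail: Rank 51/51 is certified here only by a folder script (calc/rank.py) - to be re-certified in Lean/kit; the quantitative IFT modulo O(3) with two patterns and the size of C = 1/sigma_min are the risk, not the statement.
sources: AsimowRoth1978 doi:10.1090/S0002-9947-1978-0511410-9 (infinitesimal => rigid), ConnellyWhiteley1996 doi:10.1137/S0895480192229236 (second-order rigidity; the shell-only failure mode), KusnerKusnerLagariasShlosman2018 arXiv:1611.10297, folder calc/rank.py (ranks 32/33 and 51/51, exact rational elimination)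
[crux] (B) LIPSCHITZ STABILITY OF THE fcc/hcp DOUBLE STARS (the linear rate): there are eps1, C > 0
such that for 0 <= eta <= eps1, any finsets T (shell) and U (caps) that are eps1-matched after one
linear isometry to a pattern double shell and whose 19 points {0} u T u U are pairwise >= 1-eta
apart with the dichotomy (<= 1+eta or >= 5/4) are C*eta-matched after another linear isometry to the
same kind of pattern double shell. Mechanism: the 60 unit bars (12 spokes, 24 shell contacts, 24
cap-square contacts) form a first-order rigid framework - own exact rank computation 51 = 3*19 - 6
for BOTH patterns (the bare 13-point shell has rank 32 < 33: one jitterbug flex, hence only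
sqrt(eta), see ShellSqrtFlex) - and infinitesimal rigidity gives local rigidity with a linear
estimate (inverse function theorem on a slice transverse to O(3)); the dichotomy turns
eps1-approximate contacts into two-sided bar bounds [1-eta,1+eta]. Certifiable: the rank by exact
integer arithmetic on scaled coordinates (fccInt/hcpInt, caps (+-2,0,0).. and (6,0,0),(2,-4,-4)..),
the constant by a smallest-singular-value bound. [deps: none] [difficulty: M] -/
@[route_item "route-AtomisticToContinuum-OctetTrussRigidity"]
def DoubleStarRigidity : Prop :=
  ∃ ε₁ C : ℝ, 0 < ε₁ ∧ 0 < C ∧ ∀ η : ℝ, 0 ≤ η → η ≤ ε₁ → ∀ T U : Finset (EuclideanSpace ℝ (Fin 3)), (∀ v ∈ insert (0 : EuclideanSpace ℝ (Fin 3)) (T ∪ U), ∀ w ∈ insert (0 : EuclideanSpace ℝ (Fin 3)) (T ∪ U), v ≠ w → 1 - η ≤ dist v w ∧ (dist v w ≤ 1 + η ∨ 5 / 4 ≤ dist v w)) → (∃ A : EuclideanSpace ℝ (Fin 3) →ₗᵢ[ℝ] EuclideanSpace ℝ (Fin 3), ((Literature.Geometry.DiscreteGeometry.EtaMatched (ε₁)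 T ((Literature.Geometry.DiscreteGeometry.fccKissingPattern).image A) ∧ Literature.Geometry.DiscreteGeometry.EtaMatched (ε₁) U ((Literature.Geometry.DiscreteGeometry.scaledPattern {![2, 0, 0], ![-2, 0, 0], ![0, 2, 0], ![0, -2, 0], ![0, 0, 2], ![0, 0, -2]} 2).image A)) ∨ (Literature.Geometry.DiscreteGeometry.EtaMatched (ε₁) T ((Literature.Geometry.DiscreteGeometry.hcpKissingPattern).image A) ∧ Literature.Geometry.DiscreteGeometry.EtaMatched (ε₁) U ((Literature.Geometry.DiscreteGeometry.scaledPattern {![6, 0, 0], ![0, 6, 0], ![0, 0, 6], ![2, -4, -4], ![-4, 2, -4], ![-4, -4, 2]} 18).image A)))) → ∃ A : EuclideanSpace ℝ (Fin 3) →ₗᵢ[ℝ] EuclideanSpace ℝ (Fin 3), ((Literature.Geometry.DiscreteGeometry.EtaMatched (C * η) T ((Literature.Geometry.DiscreteGeometry.fccKissingPattern).image A) ∧ Literature.Geometry.DiscreteGeometry.EtaMatched (C * η) U ((Literature.Geometry.DiscreteGeometry.scaledPattern {![2, 0, 0], ![-2, 0, 0], ![0, 2, 0], ![0, -2, 0],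 ![0, 0, 2], ![0, 0, -2]} 2).image A)) ∨ (Literature.Geometry.DiscreteGeometry.EtaMatched (C * η) T ((Literature.Geometry.DiscreteGeometry.hcpKissingPattern).image A) ∧ Literature.Geometry.DiscreteGeometry.EtaMatched (C * η) U ((Literature.Geometry.DiscreteGeometry.scaledPattern {![6, 0, 0], ![0, 6, 0], ![0, 0, 6], ![2, -4, -4], ![-4, 2, -4], ![-4, -4, 2]} 18).image A)))

/-- item stmt-AtomisticToContinuum-0751 · crux · rank 5 · open · by planner
why it might fail: As typed P sits at a point of P for every good particle (vertex-transitive limit: fine for HCP/FCC, false for dhcp polytypes); needs K1+K2+K3 with HCP optimal by ~1e-4 and a lattice-constant selection step no item supplies yet.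
sources: PartayOrtnerCsanyi2017 arXiv:1705.01751 p.4, BlancLewin2015 arXiv:1504.01153 Sec. 2.3, refuter g28-4 note 2026-08-13 on stmt-0751 (vertex-transitivity), Literature.Barriers.AtomisticToContinuum.ShortRangeStackingBlindness
[crux] HINGE: there is ONE periodic configuration P (the LJ-optimal HCP-type stacking, 0 ∈ motif)
such that for every window radius R and tolerance ε, in every sequence of LJ ground states all but
o(N) particles i admit a linear isometry A with the particles in B_R(x_i) ε-matched both ways to x_i
+ A(P.points ∩ B_R). Follows from (K1) SoftTwelveCoordination + (K2) RobustFejesTothHales + (K3)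
stacking selection (Hägg domination 0716/0737 + certified J_k) with ≤ K fault planes per ground
state. Sources: Hales2012 Thm 1; HaggStacking.lean; PartayOrtnerCsanyi2017. -/
@[route_item "route-AtomisticToContinuum-OctetTrussRigidity"]
def BulkDefectVanish : Prop :=
  ∃ P : Literature.MathematicalPhysics.StatisticalMechanics.PeriodicConfiguration 3, ∀ R ε : ℝ, 0 < R → 0 < ε → ∀ x : (N : ℕ) → (Fin N → EuclideanSpace ℝ (Fin 3)), (∀ N, Literature.MathematicalPhysics.StatisticalMechanics.IsGroundState Literature.MathematicalPhysics.StatisticalMechanics.lennardJones (x N)) → Filter.Tendsto (fun N : ℕ => (Nat.card {i : Fin N // ¬ ∃ A : EuclideanSpace ℝ (Fin 3) →ₗᵢ[ℝ] EuclideanSpace ℝ (Fin 3), (∀ p ∈ P.points, ‖p‖ ≤ R → ∃ j : Fin N, dist (x N j) (x N i + A p) ≤ ε) ∧ (∀ j : Fin N, dist (x N j) (x N i) ≤ R → ∃ p ∈ P.points, dist (x N j) (x N i + A p) ≤ ε)} : ℝ) / N) Filter.atTop (nhds 0)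

/-- item stmt-AtomisticToContinuum-0627 · crux · rank 6 · open · by planner
why it might fail: False iff optimal LJ stackings are aperiodic with unattained infimum (route RefuteCrystalPeriodicMin), i.e. Hagg domination |J2| > sum k|J_k| fails at its 1e-4 margin; print covers Bravais lattices only.
sources: BlancLewin2015 arXiv:1504.01153 Sec. 2.5 p.11, BeterminSamajTravenec2022 arXiv:2107.14020, Literature.Barriers.AtomisticToContinuum.HcpNotBravais, stmt-AtomisticToContinuum-0716/0737/0670
The infimum over periodic configurations of ℝ³ of the Lennard-Jones energy per particle is attained
(by some lattice G and finite motif F). Needs stacking selection (c) + compactness of near-optimal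
periodic configurations at bounded density / bounded-below distances; refuted if optimal LJ
stackings are aperiodic with unattained infimum (route RefuteCrystalPeriodicMin). -/
@[route_item "route-AtomisticToContinuum-OctetTrussRigidity"]
def CrysPeriodicMinAttained : Prop :=
  ∃ P : Literature.MathematicalPhysics.StatisticalMechanics.PeriodicConfiguration 3, IsLeast (Set.range fun Q : Literature.MathematicalPhysics.StatisticalMechanics.PeriodicConfiguration 3 => Q.energyPerParticle Literature.MathematicalPhysics.StatisticalMechanics.lennardJones) (P.energyPerParticle Literature.MathematicalPhysics.StatisticalMechanics.lennardJones)

/-- item stmt-AtomisticToContinuum-0626 · support · rank 9 · open · by planner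
Energetic crystallization: E(N)/N converges to the infimum over periodic (multi-lattice)
configurations of the LJ energy per particle in d = 3. Lower bound liminf ≥ ⨅ is the content ((a)
local optimality + (d) + surface term O(N^{2/3})); upper bound is filed separately. -/
@[route_item "route-AtomisticToContinuum-OctetTrussRigidity"]
def CrysEnergyLimit : Prop :=
  Filter.Tendsto (fun N : ℕ => Literature.MathematicalPhysics.StatisticalMechanics.groundStateEnergy Literature.MathematicalPhysics.StatisticalMechanics.lennardJones 3 N / N) Filter.atTop (nhds (⨅ Q : Literature.MathematicalPhysics.StatisticalMechanics.PeriodicConfiguration 3, Q.energyPerParticle Literature.MathematicalPhysics.StatisticalMechanics.lennardJones))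

/-- item stmt-AtomisticToContinuum-0752 · support · rank 9 · open · by planner
[support] SOFT ASSEMBLY LEMMA: BulkDefectVanish together with the uniform minimal distance of LJ
ground states (Literature fact LennardJonesMinimalDistance, Xue 1997 / BlancLewin2015 §2.2) implies
IsCrystallizing lennardJones 3: pick, for R_k = k, ε_k = 1/k, indices N_k ↑ and good particles i_k;
τ_k = −x_{i_k}; extract a convergent subsequence of the isometries A_k → A in O(3); minimal distance
+ discreteness of P make the ε-matching a local bijection, so Σ_i f(x_i + τ_k) → Σ_{s ∈ A(P.points)}
f(s) for f ∈ C_c; A(P) is again a PeriodicConfiguration (rotate lattice and motif), multiplicity m ≡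
1. -/
@[route_item "route-AtomisticToContinuum-OctetTrussRigidity"]
def DefectVanishCrystallizes : Prop :=
  BulkDefectVanish → Literature.MathematicalPhysics.StatisticalMechanics.LennardJonesMinimalDistance → Literature.MathematicalPhysics.StatisticalMechanics.IsCrystallizing Literature.MathematicalPhysics.StatisticalMechanics.lennardJones 3

/-- item stmt-AtomisticToContinuum-0758 · support · rank 9 · closed · moot by None · by planner
[crux] (K2) ROBUST FEJES TÓTH–HALES (pure metric geometry, no potential): there are η₀ > 0 and C < ∞
such that for every η ∈ (0, η₀), every R ≥ R₀ and every finite S ⊂ B_R(p) ⊂ ℝ³ with pairwise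
distances ≥ 1 − η in which every point has exactly twelve points of S ∪ (exterior) within distance 1
+ η and none at distance in (1 + η, 5/4): the twelve-shell of every point of S ∩ B_{R/2}(p) is,
after a rotation, Cη-close to the FCC kissing pattern (cuboctahedron) or the HCP kissing pattern
(anticuboctahedron), and consequently S ∩ B_{R/2}(p) is C(R)η-close to a rigid-motion image of a
fragment of a Barlow stacking of triangular layers (spacing 1). The case η = 0, S infinite is
Hales2012 Thm 1 (Fejes Tóth conjecture) + [Hal12a, Sec. 1.3] (FCC/HCP pattern everywhere ⇒ hexagonal
layers); Hales2012 Lemma 2 (gap: no distances in (2, 2h₀), h₀ = 1.26, in kissing-twelve packings) is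
the origin of the 5/4 gap. Frustration content: an icosahedral shell is softly twelve-coordinated
for η ≳ 0.05 but its neighbours cannot all be; the statement quantifies that polytetrahedral order
cannot propagate. To be typed once fccKissingPattern / hcpKissingPattern / BarlowStacking are
defined (definition requests -/
@[route_item "route-AtomisticToContinuum-OctetTrussRigidity"]
def RobustFejesTothHales : Prop :=
  ∃ η₀ C R₀ : ℝ, ∃ C' : ℝ → ℝ, 0 < η₀ ∧ ∀ η : ℝ, 0 < η → η < η₀ → ∀ R : ℝ, R₀ ≤ R → ∀ (p : EuclideanSpace ℝ (Fin 3)) (S : Set (EuclideanSpace ℝ (Fin 3))), (∀ x ∈ S, ∀ y ∈ S, x ≠ y → 1 - η ≤ dist x y) → (∀ x ∈ S, dist x p ≤ R → {y ∈ S | y ≠ x ∧ dist x y ≤ 1 + η}.ncard = 12 ∧ ∀ y ∈ S, ¬ (1 + η < dist x y ∧ dist x y < 5 / 4)) → (∀ x ∈ S, dist x p ≤ R / 2 → ∃ T : Finset (EuclideanSpace ℝ (Fin 3)), (↑T : Set (EuclideanSpace ℝ (Fin 3))) = (fun y => y - x) '' {y ∈ S | y ≠ x ∧ dist x y ≤ 1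 + η} ∧ (Literature.Geometry.DiscreteGeometry.ShellCloseTo (C * η) T Literature.Geometry.DiscreteGeometry.fccKissingPattern ∨ Literature.Geometry.DiscreteGeometry.ShellCloseTo (C * η) T Literature.Geometry.DiscreteGeometry.hcpKissingPattern)) ∧ (∃ (s : ℤ → ℤ) (g : EuclideanSpace ℝ (Fin 3) ≃ᵃⁱ[ℝ] EuclideanSpace ℝ (Fin 3)), Literature.MathematicalPhysics.StatisticalMechanics.IsHaggSeq s ∧ ∀ x ∈ S, dist x p ≤ R / 2 → ∃ z ∈ Literature.MathematicalPhysics.StatisticalMechanics.barlowStacking 1 (Real.sqrt (2 / 3)) s, dist x (g z) ≤ C' R * η)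

/-- item stmt-AtomisticToContinuum-4106 · support · rank 9 · closed · moot by None · by planner
[support] THE GLUE 0758 = (C) o (B) o (A): SoftDoubleShell -> DoubleStarRigidity -> SoftBallBarlow
-> flyspeck_L12 -> Hales2012_kissingConfigCongruent -> RobustFejesTothHales. Proof (bookkeeping, all
choices explicit): eps1, C_B from (B); eta_A := eta0 of (A) at eps := eps1; delta0, K from (C); set
eta0 := min(eta_A, eps1, delta0 / max 1 C_B), C := C_B, R0 := 12, C'(R) := K(R-4) * max 1 C_B. For x
in S cap B_{R-4}(p) all points within 4 of x lie in B_R(p), so (A) gives T, U, A with eps1-matching;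
separation + the gap at points of B_R give the dichotomy on {0} u T u U; (B) gives C_B*eta-matching,
hence ShellCloseTo (C*eta) on B_{R/2} (R >= 8); EtaMatched.mono lifts to delta := eta * max 1 C_B
(so eta <= delta <= delta0) and (C) at radius R-4 gives s, g with closeness K(R-4)*delta on B_{R-6},
which contains B_{R/2} for R >= 12. [deps: SoftDoubleShell, DoubleStarRigidity, SoftBallBarlow,
RobustFejesTothHales] [difficulty: M] -/
@[route_item "route-AtomisticToContinuum-OctetTrussRigidity"]
def RobustFromParts : Prop :=
  SoftDoubleShell → DoubleStarRigidity → SoftBallBarlow → Literature.Geometry.DiscreteGeometry.flyspeck_L12 → Literature.Geometry.DiscreteGeometry.Hales2012_kissingConfigCongruent → RobustFejesTothHales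

/-- item stmt-AtomisticToContinuum-4107 · support · rank 9 · closed · moot by None · by planner
[support] NEGATIVE SIDE, QUANTITATIVE JITTERBUG (why 0758 cannot be a shell-by-shell statement):
there are c, eta1 > 0 such that for every 0 < eta < eta1 some twelve unit vectors, pairwise >= 1
apart, with >= 24 soft contacts (48 ordered pairs at distance <= 1+eta) - i.e. satisfying every
single-centre hypothesis of 0758 and even the maximal contact count of Flatley-Tarasov-Taylor-Theil
- are NOT c*sqrt(eta)-close (ShellCloseTo) to the fcc nor to the hcp pattern. Construction: twist
the cuboctahedron along Fuller's jitterbug by angle theta (edges rigid, vertices on a sphere of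
radius R(theta) = 1 - a*theta^2 + O(theta^4), R even in theta), rescale to the unit sphere: contacts
become 1/R(theta) <= 1 + eta for theta = sqrt(eta/a), while the displacement along the non-trivial
first-order flex (rank 32/33, own computation) is >= c2*theta transverse to the O(3)-orbit. Sharpens
barrier FlexibleKissingArrangements (whose witness is the contact-free icosahedron) to the
maximal-contact shells. [difficulty: M] -/
@[route_item "route-AtomisticToContinuum-OctetTrussRigidity"]
def ShellSqrtFlex : Prop :=
  ∃ c η₁ : ℝ, 0 < c ∧ 0 < η₁ ∧ ∀ η : ℝ, 0 < η → η < η₁ → ∃ T : Finset (EuclideanSpace ℝ (Fin 3)), T.card = 12 ∧ (∀ t ∈ T, ‖t‖ = 1) ∧ (∀ t ∈ T, ∀ t' ∈ T, t ≠ t' → 1 ≤ dist t t') ∧ 48 ≤ ((T ×ˢ T).filter fun q => q.1 ≠ q.2 ∧ dist q.1 q.2 ≤ 1 + η).card ∧ ¬ Literature.Geometry.DiscreteGeometry.ShellCloseTo (c * Real.sqrt η) T Literature.Geometry.DiscreteGeometry.fccKissingPattern ∧ ¬ Literature.Geometry.DiscreteGeometry.ShellCloseTo (c * Real.sqrt η)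 T Literature.Geometry.DiscreteGeometry.hcpKissingPattern

/-- item stmt-AtomisticToContinuum-4108 · support · rank 9 · closed · moot by None · by planner
[support] DISCRETE KORN INEQUALITY ON BARLOW TRUSSES, UNIFORM IN THE STACKING (linear form; the
card's T3; NOT load-bearing for 0758 as typed - it would only sharpen C'(R) - but it is the rigidity
input B4 of card brittle-rung-mie-descent and of energy/surface-scaling consumers): there is C such
that for every Hagg sequence s, every ball B_R(p) with R >= 3 and every displacement field v on the
nodes of Lambda = barlowStacking 1 sqrt(2/3) s there is an infinitesimal rigid motion z -> W z + b
(W skew) with sum over nodes in B_{R/2} of |v z - (W z + b)|^2 <= C R^2 * sum over unit bonds inside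
B_R of <v z - v z', z - z'>^2. Mechanism: tetrahedral and octahedral cells are first-order rigid
(Cauchy-Dehn; octahedron isostatic 12 = 3*6-6) and share triangular faces, so cell-wise Korn +
continuum Korn/Poincare on the union (a John domain) gives the inequality with a constant seeing
only the two cell types (Schmidt2009, LazzaroniPalombaroSchlomerkemper2017 for 3-D lattices with
tetrahedral decompositions; FrieseckeJamesMuller2002 for the nonlinear upgrade, not claimed).
Hypothesis radius R, conclusion radius R/2: boundary cells cut by the ball may flex, interior stars
are complete once R >= -/
@[route_item "route-AtomisticToContinuum-OctetTrussRigidity"]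
def TrussKorn : Prop :=
  ∃ C : ℝ, 0 < C ∧ ∀ s : ℤ → ℤ, Literature.MathematicalPhysics.StatisticalMechanics.IsHaggSeq s → ∀ (R : ℝ) (p : EuclideanSpace ℝ (Fin 3)) (v : EuclideanSpace ℝ (Fin 3) → EuclideanSpace ℝ (Fin 3)), 3 ≤ R → ∃ (W : EuclideanSpace ℝ (Fin 3) →ₗ[ℝ] EuclideanSpace ℝ (Fin 3)) (b : EuclideanSpace ℝ (Fin 3)), (∀ y z : EuclideanSpace ℝ (Fin 3), inner ℝ (W y) z = - inner ℝ y (W z)) ∧ ∑ᶠ z ∈ {z : EuclideanSpace ℝ (Fin 3) | z ∈ Literature.MathematicalPhysics.StatisticalMechanics.barlowStacking 1 (Real.sqrt (2 / 3)) s ∧ dist z p ≤ R / 2}, ‖v z - (W z + b)‖ ^ 2 ≤ C * R ^ 2 * ∑ᶠ q ∈ {q : EuclideanSpace ℝ (Fin 3) × EuclideanSpace ℝ (Fin 3) | q.1 ∈ Literature.MathematicalPhysics.StatisticalMechanics.barlowStacking 1 (Real.sqrt (2 / 3)) s ∧ q.2 ∈ Literature.MathematicalPhysics.StatisticalMechanics.barlowStacking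 1 (Real.sqrt (2 / 3)) s ∧ dist q.1 q.2 = 1 ∧ dist q.1 p ≤ R ∧ dist q.2 p ≤ R}, inner ℝ (v q.1 - v q.2) (q.1 - q.2) ^ 2

/-- item stmt-AtomisticToContinuum-4109 · assembly · rank 1 · closed · moot by None · by planner
[assembly] SoftDoubleShell -> DoubleStarRigidity -> SoftBallBarlow -> RobustFromParts ->
DefectVanishCrystallizes -> BulkDefectVanish -> LennardJonesMinimalDistance (tree fact, discharged)
-> periodic minimum attained (0627) -> E(N)/N -> inf periodic (0626) -> Crystallization. Proof =
CrystalKissingRigidity's 0753 after dropping the first four hypotheses (which feed 0751 informally,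
see rationale): DefectVanishCrystallizes gives IsCrystallizing; IsLeast.csInf_eq turns the limit
into HasPeriodicGroundStateEnergy (cf. closed item 0622,
crystallization_of_isLeast_tendsto_isCrystallizing). [difficulty: provable-now] -/
@[route_item "route-AtomisticToContinuum-OctetTrussRigidity"]
def Assembly : Prop :=
  SoftDoubleShell → DoubleStarRigidity → SoftBallBarlow → RobustFromParts → DefectVanishCrystallizes → BulkDefectVanish → Literature.MathematicalPhysics.StatisticalMechanics.LennardJonesMinimalDistance → (∃ P : Literature.MathematicalPhysics.StatisticalMechanics.PeriodicConfiguration 3, IsLeast (Set.range fun Q : Literature.MathematicalPhysics.StatisticalMechanics.PeriodicConfiguration 3 => Q.energyPerParticle Literature.MathematicalPhysics.StatisticalMechanics.lennardJones) (P.energyPerParticle Literature.MathematicalPhysics.StatisticalMechanics.lennardJones)) → Filter.Tendsto (fun N : ℕ => Literature.MathematicalPhysics.StatisticalMechanics.groundStateEnergy Literature.MathematicalPhysics.StatisticalMechanics.lennardJones 3 N / N) Filter.atTop (nhds (⨅ Q : Literature.MathematicalPhysics.StatisticalMechanics.PeriodicConfiguration 3, Q.energyPerParticle Literature.MathematicalPhysics.StatisticalMechanics.lennardJones))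 → Literature.MathematicalPhysics.StatisticalMechanics.Crystallization

end Summit.AtomisticToContinuum.Crystallization.Theses.OctetTrussRigidity
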